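import Summits.Ventures.PercRepro.RankLevelSetRuleQSliceThirdUntrunc

/-!
# PercRepro — THE FOURTH UNTRUNCATED SLICE `u = k + 2` ON EVERY CELL OF EVERY FAMILY `k ≥ 13` (night-1, gen 22; dossier §33.7)

The pattern of RankLevelSetRuleQSliceThirdUntrunc one slice further (`u = k + 2`, `q = m + k + 2`), for the families `k ≥ 13`
(on `k = 11, 12` the cell `m = 3` has `T_{k+2}(3) > 1` — the «T ≤ 1» route ends there; `k ≤ 10` is p4's complete map):
* **`xq_sq_le_sharper`** — the sharper Wallis bound `X_Q² ≤ 4(2Q+1)²/(5Q+4)` (the induction of `xq_sq_le_sharp` with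
  `(2Q+2)²(5Q+9) ≤ (2Q+3)²(5Q+4)`; equality at `Q = 1`), hence **`diag_two_sq_le_sharper`** — `(2J_2(m))² ≤ 4/(5m+9)`;
* `m = 2`: `T_{k+2}(2) ≤ 13/8` (the chain with `P₂(k+2, k) = (k+2)(k+3)/((k+1)(2k+7))`) against the slack
  `1 + ρ(3k+8, k+4) − ρ(k+6, 2) ≥ 1 + 7/4 − 9/8` — `fourth_untrunc_two`;
* `3 ≤ m ≤ k² − 2`: the criterion with `T_{k+2}(3) ≤ 1` — for `k ≥ 25` by the chain with the exact first term (a degree-8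
  polynomial with positive coefficients in `k − 25`), for `13 ≤ k ≤ 24` by exact evaluation — `fourth_untrunc_bottom`;
* `m ≥ k² − 1`: one slice step up from `third_untrunc_slice_every` at fixed `q`; the monotone step needs `(k+1)·(2J_2) ≤ 26/27`,
  which the sharper Wallis bound gives from `m = k² − 1` on (`464k² − 5832k − 212 ≥ 0`), and `27·C(2k+2, k+1) ≤ 2·C(k²+d, d)`
  (`tK4`, two-step induction) — `fourth_untrunc_large`;
* **`fourth_untrunc_slice_every (k q) (13 ≤ k) (k + 2 ≤ q) : Φ(q+k, q) ≤ R̂(q, k, q − (k + 2))`**;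
  **`ruleQRecv_ge_phiK_fourth_untrunc_every`** — the matroid level.
Axioms: standard.
-/

namespace PercRepro

open Finset

/-! ### §1 The sharper Wallis bound -/

/-- **`X_Q² ≤ 4(2Q+1)²/(5Q+4)`** for `Q ≥ 1` (equality at `Q = 1`; asymptotically `(16/5)Q` against `πQ`). -/
lemma xq_sq_le_sharper (Q : ℕ) (hQ : 1 ≤ Q) :
    ((4 : ℚ) ^ Q / ((2 * Q).choose Q : ℚ)) ^ 2 ≤ 4 * (2 * (Q : ℚ) + 1) ^ 2 / (5 * (Q : ℚ) + 4) := by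
  induction Q, hQ using Nat.le_induction with
  | base => norm_num [Nat.choose_one_right]
  | succ Q _ ih =>
    rw [xq_succ, mul_pow]
    have hpos : (0 : ℚ) ≤ ((2 * (Q : ℚ) + 2) / (2 * (Q : ℚ) + 1)) ^ 2 := by positivity
    calc ((4 : ℚ) ^ Q / ((2 * Q).choose Q : ℚ)) ^ 2 * ((2 * (Q : ℚ) + 2) / (2 * (Q : ℚ) + 1)) ^ 2
        ≤ 4 * (2 * (Q : ℚ) + 1) ^ 2 / (5 * (Q : ℚ) + 4) * ((2 * (Q : ℚ) + 2) / (2 * (Q : ℚ) + 1)) ^ 2 :=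
          mul_le_mul_of_nonneg_right ih hpos
      _ = 4 * (2 * (Q : ℚ) + 2) ^ 2 / (5 * (Q : ℚ) + 4) := by field_simp
      _ ≤ 4 * (2 * ((Q + 1 : ℕ) : ℚ) + 1) ^ 2 / (5 * ((Q + 1 : ℕ) : ℚ) + 4) := by
          push_cast
          rw [div_le_div_iff₀ (by positivity) (by positivity)]
          nlinarith

/-- **`(2·J_2(m))² ≤ 4/(5m+9)`**. -/
lemma diag_two_sq_le_sharper (m : ℕ) : (2 * sliceS (m + 1) m 2) ^ 2 ≤ 4 / (5 * (m : ℚ) + 9) := by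
  have h : sliceS (m + 1) m 2
      = ((4 : ℚ) ^ (m + 1) / ((2 * m + 2).choose (m + 1) : ℚ)) / (2 * (2 * (m : ℚ) + 3)) :=
    slice_two_succ_diag m
  have hw := xq_sq_le_sharper (m + 1) (by omega)
  rw [show 2 * (m + 1) = 2 * m + 2 by ring] at hw
  push_cast at hw
  rw [h]
  calc (2 * ((4 : ℚ) ^ (m + 1) / ((2 * m + 2).choose (m + 1) : ℚ) / (2 * (2 * (m : ℚ) + 3)))) ^ 2
      = ((4 : ℚ) ^ (m + 1) / ((2 * m + 2).choose (m + 1) : ℚ)) ^ 2 / (2 * (m : ℚ) + 3) ^ 2 := by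
        field_simp
    _ ≤ (4 * (2 * ((m : ℚ) + 1) + 1) ^ 2 / (5 * ((m : ℚ) + 1) + 4)) / (2 * (m : ℚ) + 3) ^ 2 :=
        div_le_div_of_nonneg_right hw (by positivity)
    _ = 4 / (5 * (m : ℚ) + 9) := by field_simp; ring

/-! ### §2 The cell `m = 3`: `T_{k+2}(3) ≤ 1` for `k ≥ 13` -/

/-- `P₀(k+2, k) < 1` and `1/(1 − P₀) = (2k²+11k+9)/(k²+5k+1)`. -/
lemma threeRatio_kp2 (k : ℕ) :
    threeRatio (k + 2) k < 1 ∧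
      1 / (1 - threeRatio (k + 2) k) = (2 * (k : ℚ) ^ 2 + 11 * k + 9) / ((k : ℚ) ^ 2 + 5 * k + 1) := by
  unfold threeRatio
  push_cast
  constructor
  · rw [div_lt_one (by positivity)]; nlinarith
  · have h1 : (0 : ℚ) < ((k : ℚ) + 1) * ((k : ℚ) + 2 + k + 7) := by positivity
    have h2 : (0 : ℚ) < (k : ℚ) ^ 2 + 5 * k + 1 := by positivity
    rw [eq_div_iff h2.ne', one_div, inv_mul_eq_div, div_eq_iff (by
      rw [sub_ne_zero]; intro heq; rw [eq_div_iff h1.ne'] at heq; nlinarith)]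
    field_simp
    ring

/-- **`T_{k+2}(3) ≤ 1` for `k ≥ 25`** by the chain with the exact first term. -/
lemma sliceTail_kp2_three_le_one_of_large (k : ℕ) (hk : 25 ≤ k) : sliceTail (k + 2) k 3 ≤ 1 := by
  obtain ⟨hP, hR⟩ := threeRatio_kp2 k
  have h := sliceTail_three_le_chain (k + 2) k hP
  rw [hR, sliceThreeTerm_zero_eq] at h
  refine h.trans ?_
  obtain ⟨n, rfl⟩ : ∃ n, k = n + 25 := ⟨k - 25, by omega⟩
  push_cast
  have hn : (0 : ℚ) ≤ n := by positivity
  rw [div_mul_eq_mul_div, div_mul_eq_mul_div, div_le_one (by positivity)]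
  field_simp
  nlinarith [pow_nonneg hn 2, pow_nonneg hn 3, pow_nonneg hn 4, pow_nonneg hn 5, pow_nonneg hn 6,
    pow_nonneg hn 7, pow_nonneg hn 8, mul_nonneg hn (pow_nonneg hn 2), mul_nonneg hn (pow_nonneg hn 3),
    mul_nonneg hn (pow_nonneg hn 4), mul_nonneg hn (pow_nonneg hn 5), mul_nonneg hn (pow_nonneg hn 6),
    mul_nonneg hn (pow_nonneg hn 7)]

/-- **`T_{k+2}(3) ≤ 1` for `13 ≤ k ≤ 24`** by exact evaluation. -/
lemma sliceTail_kp2_three_le_one_of_small (k : ℕ) (h13 : 13 ≤ k) (h24 : k ≤ 24) : sliceTail (k + 2) k 3 ≤ 1 := by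
  rw [sliceTail_three_eq]
  interval_cases k <;>
    (simp only [Finset.sum_range_succ, Finset.sum_range_zero, sliceThreeTerm, Nat.choose_eq_descFactorial_div_factorial]
     norm_num [Nat.descFactorial, Nat.factorial])

/-- **`T_{k+2}(3) ≤ 1` for every `k ≥ 13`.** -/
theorem sliceTail_kp2_three_le_one (k : ℕ) (hk : 13 ≤ k) : sliceTail (k + 2) k 3 ≤ 1 := by
  rcases Nat.lt_or_ge k 25 with h | h
  · exact sliceTail_kp2_three_le_one_of_small k hk (by omega)
  · exact sliceTail_kp2_three_le_one_of_large k h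

/-- **THE BOTTOM REGIME OF `u = k + 2`**: `3 ≤ m ≤ k² − 2` ⇒ `Φ(q+k, q) ≤ R̂(q, k, m)` (`q = m + k + 2`, `k ≥ 13`). -/
theorem fourth_untrunc_bottom (k m : ℕ) (hk : 13 ≤ k) (h3 : 3 ≤ m) (hm : m + 2 ≤ k * k) :
    phiK (m + (k + 2) + k) (m + (k + 2)) ≤ rhat (m + (k + 2)) k m :=
  slice_bottom_of_three_le_one (k + 2) k m (by omega) (by nlinarith) h3 (by nlinarith)
    (sliceTail_kp2_three_le_one k hk)

/-! ### §3 The cell `m = 2` -/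

/-- `P₂(k+2, k) < 1` and `1/(1 − P₂) = (2k²+9k+7)/(k²+4k+1)`. -/
lemma twoRatio_kp2 (k : ℕ) :
    twoRatio (k + 2) k < 1 ∧
      1 / (1 - twoRatio (k + 2) k) = (2 * (k : ℚ) ^ 2 + 9 * k + 7) / ((k : ℚ) ^ 2 + 4 * k + 1) := by
  unfold twoRatio
  push_cast
  constructor
  · rw [div_lt_one (by positivity)]; nlinarith
  · have h1 : (0 : ℚ) < ((k : ℚ) + 1) * ((k : ℚ) + 2 + k + 5) := by positivity
    have h2 : (0 : ℚ) < (k : ℚ) ^ 2 + 4 * k + 1 := by positivity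
    rw [eq_div_iff h2.ne', one_div, inv_mul_eq_div, div_eq_iff (by
      rw [sub_ne_zero]; intro heq; rw [eq_div_iff h1.ne'] at heq; nlinarith)]
    field_simp
    ring

/-- **`T_{k+2}(2) ≤ 13/8` for `k ≥ 13`** (the chain with the bracket `≤ 9/4`). -/
lemma sliceTail_kp2_two_le (k : ℕ) (hk : 13 ≤ k) : sliceTail (k + 2) k 2 ≤ 13 / 8 := by
  have hk' : (13 : ℚ) ≤ k := by exact_mod_cast hk
  obtain ⟨hP, hR⟩ := twoRatio_kp2 k
  have h := sliceTail_two_le_chain (k + 2) k hP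
  rw [hR, sliceTwoTerm_zero_eq] at h
  push_cast at h
  have x1 : ((k : ℚ) + 1) / ((k : ℚ) + 2 + k + 3) ≤ 1 / 2 := by
    rw [div_le_div_iff₀ (by positivity) (by norm_num)]; linarith
  have x2 : ((k : ℚ) + 2) / ((k : ℚ) + 2 + k + 4) ≤ 1 / 2 := by
    rw [div_le_div_iff₀ (by positivity) (by norm_num)]; linarith
  have x10 : 0 ≤ ((k : ℚ) + 1) / ((k : ℚ) + 2 + k + 3) := by positivity
  have x20 : 0 ≤ ((k : ℚ) + 2) / ((k : ℚ) + 2 + k + 4) := by positivity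
  have hbr : 1 + 2 * (((k : ℚ) + 1) / ((k : ℚ) + 2 + k + 3))
      + ((k : ℚ) + 1) / ((k : ℚ) + 2 + k + 3) * (((k : ℚ) + 2) / ((k : ℚ) + 2 + k + 4)) ≤ 9 / 4 := by
    nlinarith [mul_le_mul x1 x2 x20 (by norm_num)]
  have hpre : (0 : ℚ) ≤ ((k : ℚ) + 2 + 1) * ((k : ℚ) + 2 + 2) / (((k : ℚ) + 2 + k + 1) * ((k : ℚ) + 2 + k + 2)) := by
    positivity
  have hR0 : (0 : ℚ) ≤ (2 * (k : ℚ) ^ 2 + 9 * k + 7) / ((k : ℚ) ^ 2 + 4 * k + 1) := by positivity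
  have hfin : ((k : ℚ) + 2 + 1) * ((k : ℚ) + 2 + 2) / (((k : ℚ) + 2 + k + 1) * ((k : ℚ) + 2 + k + 2)) * (9 / 4)
      * ((2 * (k : ℚ) ^ 2 + 9 * k + 7) / ((k : ℚ) ^ 2 + 4 * k + 1)) ≤ 13 / 8 := by
    rw [div_mul_eq_mul_div, div_mul_div_comm, div_le_div_iff₀ (by positivity) (by norm_num)]
    nlinarith [pow_nonneg (by linarith : (0 : ℚ) ≤ k) 2, pow_nonneg (by linarith : (0 : ℚ) ≤ k) 3,
      pow_nonneg (by linarith : (0 : ℚ) ≤ k) 4]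
  calc sliceTail (k + 2) k 2
      ≤ ((k : ℚ) + 2 + 1) * ((k : ℚ) + 2 + 2) / (((k : ℚ) + 2 + k + 1) * ((k : ℚ) + 2 + k + 2))
          * (1 + 2 * (((k : ℚ) + 1) / ((k : ℚ) + 2 + k + 3))
            + ((k : ℚ) + 1) / ((k : ℚ) + 2 + k + 3) * (((k : ℚ) + 2) / ((k : ℚ) + 2 + k + 4)))
          * ((2 * (k : ℚ) ^ 2 + 9 * k + 7) / ((k : ℚ) ^ 2 + 4 * k + 1)) := h
    _ ≤ ((k : ℚ) + 2 + 1) * ((k : ℚ) + 2 + 2) / (((k : ℚ) + 2 + k + 1) * ((k : ℚ) + 2 + k + 2)) * (9 / 4)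
          * ((2 * (k : ℚ) ^ 2 + 9 * k + 7) / ((k : ℚ) ^ 2 + 4 * k + 1)) := by gcongr
    _ ≤ 13 / 8 := hfin

/-- **`ρ(3k+8, k+4) ≥ 7/4`** (`k ≥ 2`), in the spelling of `phiK_le_rhat_of_sliceTail` at `m = 2`, `u = k + 2`. -/
lemma rho_fourth_two_ge (k : ℕ) (hk : 2 ≤ k) :
    (7 : ℚ) / 4 ≤ (∑ i ∈ range (2 + (k + 2) + 1), ((2 * (2 + (k + 2)) + k).choose i : ℚ))
      / ((2 * (2 + (k + 2)) + k).choose (2 + (k + 2)) : ℚ) := by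
  rw [rho_as_prod_sum (2 * (2 + (k + 2)) + k) (2 + (k + 2)) (by omega)]
  have hsub : ∑ s ∈ range 5, ∏ t ∈ range s,
        ((((2 + (k + 2) : ℕ) : ℚ) - t) / (((2 * (2 + (k + 2)) + k : ℕ) : ℚ) - ((2 + (k + 2) : ℕ) : ℚ) + 1 + t))
      ≤ ∑ s ∈ range (2 + (k + 2) + 1), ∏ t ∈ range s,
        ((((2 + (k + 2) : ℕ) : ℚ) - t) / (((2 * (2 + (k + 2)) + k : ℕ) : ℚ) - ((2 + (k + 2) : ℕ) : ℚ) + 1 + t)) := by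
    apply Finset.sum_le_sum_of_subset_of_nonneg (Finset.range_mono (by omega))
    intro s hs _
    rw [Finset.mem_range] at hs
    apply Finset.prod_nonneg
    intro t ht
    rw [Finset.mem_range] at ht
    have ht0 : (0 : ℚ) ≤ t := by positivity
    apply div_nonneg
    · push_cast
      have : (t : ℚ) ≤ 2 + ((k : ℚ) + 2) := by exact_mod_cast (by omega : t ≤ 2 + (k + 2))
      linarith
    · push_cast; linarith
  refine le_trans ?_ hsub
  simp only [Finset.sum_range_succ, Finset.sum_range_zero, Finset.prod_range_succ, Finset.prod_range_zero]
  push_cast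
  have hk' : (2 : ℚ) ≤ k := by exact_mod_cast hk
  have f1 : (1 : ℚ) / 2 ≤ (2 + ((k : ℚ) + 2) - 0) / (2 * (2 + ((k : ℚ) + 2)) + k - (2 + ((k : ℚ) + 2)) + 1 + 0) := by
    rw [div_le_div_iff₀ (by norm_num) (by linarith)]; linarith
  have f2 : (3 : ℚ) / 7 ≤ (2 + ((k : ℚ) + 2) - 1) / (2 * (2 + ((k : ℚ) + 2)) + k - (2 + ((k : ℚ) + 2)) + 1 + 1) := by
    rw [div_le_div_iff₀ (by norm_num) (by linarith)]; linarith
  have f3 : (1 : ℚ) / 3 ≤ (2 + ((k : ℚ) + 2) - 2) / (2 * (2 + ((k : ℚ) + 2)) + k - (2 + ((k : ℚ) + 2)) + 1 + 2) := by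
    rw [div_le_div_iff₀ (by norm_num) (by linarith)]; linarith
  have f4 : (1 : ℚ) / 4 ≤ (2 + ((k : ℚ) + 2) - 3) / (2 * (2 + ((k : ℚ) + 2)) + k - (2 + ((k : ℚ) + 2)) + 1 + 3) := by
    rw [div_le_div_iff₀ (by norm_num) (by linarith)]; linarith
  have g1 : (0 : ℚ) ≤ (2 + ((k : ℚ) + 2) - 0) / (2 * (2 + ((k : ℚ) + 2)) + k - (2 + ((k : ℚ) + 2)) + 1 + 0) := by
    apply div_nonneg <;> linarith
  have g2 : (0 : ℚ) ≤ (2 + ((k : ℚ) + 2) - 1) / (2 * (2 + ((k : ℚ) + 2)) + k - (2 + ((k : ℚ) + 2)) + 1 + 1) := by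
    apply div_nonneg <;> linarith
  have g3 : (0 : ℚ) ≤ (2 + ((k : ℚ) + 2) - 2) / (2 * (2 + ((k : ℚ) + 2)) + k - (2 + ((k : ℚ) + 2)) + 1 + 2) := by
    apply div_nonneg <;> linarith
  have h12 := mul_le_mul f1 f2 (by norm_num) g1
  have h123 := mul_le_mul h12 f3 (by norm_num) (mul_nonneg g1 g2)
  have h1234 := mul_le_mul h123 f4 (by norm_num) (mul_nonneg (mul_nonneg g1 g2) g3)
  nlinarith [h12, h123, h1234]

/-- **`ρ(k+6, 2) ≤ 9/8`** for `k ≥ 12`: `ρ(k+6, 2) = 1 + 2(k+7)/((k+5)(k+6))`. -/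
lemma rho_kp6_two_le (k : ℕ) (hk : 12 ≤ k) :
    (∑ i ∈ range (2 + 1), ((2 * 2 + (k + 2)).choose i : ℚ)) / ((2 * 2 + (k + 2)).choose 2 : ℚ) ≤ 9 / 8 := by
  simp only [Finset.sum_range_succ, Finset.sum_range_zero, Nat.choose_zero_right, Nat.choose_one_right,
    Nat.cast_one, zero_add]
  rw [Nat.cast_choose_two]
  push_cast
  have hk' : (12 : ℚ) ≤ k := by exact_mod_cast hk
  rw [div_le_div_iff₀ (by nlinarith) (by norm_num)]
  nlinarith

/-- **The cell `m = 2` of `u = k + 2`** (`q = k + 4`, `k ≥ 13`). -/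
theorem fourth_untrunc_two (k : ℕ) (hk : 13 ≤ k) :
    phiK (2 + (k + 2) + k) (2 + (k + 2)) ≤ rhat (2 + (k + 2)) k 2 := by
  apply phiK_le_rhat_of_sliceTail (k + 2) k 2 (by omega)
  have h1 := sliceTail_kp2_two_le k hk
  have h2 := rho_fourth_two_ge k (by omega)
  have h3 := rho_kp6_two_le k (by omega)
  linarith

/-! ### §4 The large-q half: one step up from `u = k + 1` -/

/-- **The `k`-recursion `tK4`**: `27·C(2k+2, k+1) ≤ 2·C(k² + d, d)`, `d = ⌊(k−1)/2⌋`, for `k ≥ 13`. -/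
lemma tK4 (k : ℕ) (hk : 13 ≤ k) :
    27 * (2 * (k + 1)).choose (k + 1) ≤ 2 * (k * k + (k - 1) / 2).choose ((k - 1) / 2) := by
  obtain ⟨n, rfl⟩ : ∃ n, k = 13 + n := ⟨k - 13, by omega⟩
  clear hk
  induction n using Nat.twoStepInduction with
  | zero =>
    rw [show Nat.choose (2 * (13 + 0 + 1)) (13 + 0 + 1) = 40116600 by decide,
      show (13 + 0 - 1) / 2 = 6 from rfl, show (13 + 0) * (13 + 0) + 6 = 175 from rfl,
      show Nat.choose 175 6 = 36582584325 by
        rw [Nat.choose_eq_descFactorial_div_factorial]; norm_num [Nat.descFactorial, Nat.factorial]]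
    norm_num
  | one =>
    rw [show Nat.choose (2 * (13 + 1 + 1)) (13 + 1 + 1) = 155117520 by decide,
      show (13 + 1 - 1) / 2 = 6 from rfl, show (13 + 1) * (13 + 1) + 6 = 202 from rfl,
      show Nat.choose 202 6 = 87544611330 by
        rw [Nat.choose_eq_descFactorial_div_factorial]; norm_num [Nat.descFactorial, Nat.factorial]]
    norm_num
  | more n ih _ =>
    set k := 13 + n with hkdef
    rw [show 13 + (n + 2) = k + 2 by omega]
    set d := (k - 1) / 2 with hd
    have hd6 : 6 ≤ d := by omega
    have hd2 : (k + 2 - 1) / 2 = d + 1 := by omega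
    rw [hd2]
    have hA : (2 * (k + 2 + 1)).choose (k + 2 + 1) ≤ 16 * (2 * (k + 1)).choose (k + 1) := by
      have e1 := choose_two_mul_succ_le (k + 1)
      have e2 := choose_two_mul_succ_le (k + 2)
      rw [show k + 1 + 1 = k + 2 by ring] at e1
      rw [show k + 2 + 1 = k + 2 + 1 by ring] at e2
      omega
    have hB : (2 * n + 24) * (k * k + d).choose d ≤ ((k + 2) * (k + 2) + (d + 1)).choose (d + 1) := by
      have e1 := Nat.add_one_mul_choose_eq (k * k + d) d
      have e2 : (k * k + d + 1).choose (d + 1) ≤ ((k + 2) * (k + 2) + (d + 1)).choose (d + 1) :=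
        Nat.choose_le_choose (d + 1) (by nlinarith)
      have h2d : 2 * d + 1 ≤ k := by omega
      have h2d' : k ≤ 2 * d + 2 := by omega
      have hkk := Nat.mul_le_mul_left k h2d
      have e3 : (2 * n + 24) * (d + 1) ≤ k * k + d + 1 := by nlinarith [h2d, h2d', hkk, hkdef]
      calc (2 * n + 24) * (k * k + d).choose d
          ≤ (k * k + d + 1) * (k * k + d).choose d / (d + 1) := by
            rw [Nat.le_div_iff_mul_le (by omega)]
            nlinarith
        _ = (k * k + d + 1).choose (d + 1) := by
            rw [e1, Nat.mul_div_cancel _ (by omega)]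
        _ ≤ _ := e2
    calc 27 * (2 * (k + 2 + 1)).choose (k + 2 + 1)
        ≤ 27 * (16 * (2 * (k + 1)).choose (k + 1)) := Nat.mul_le_mul_left _ hA
      _ = 16 * (27 * (2 * (k + 1)).choose (k + 1)) := by ring
      _ ≤ 16 * (2 * (k * k + d).choose d) := Nat.mul_le_mul_left _ ih
      _ = 2 * (16 * (k * k + d).choose d) := by ring
      _ ≤ 2 * ((2 * n + 24) * (k * k + d).choose d) := by
          apply Nat.mul_le_mul_left; exact Nat.mul_le_mul_right _ (by omega)
      _ ≤ _ := Nat.mul_le_mul_left _ hB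

/-- **The monotone step for the fourth untruncated slice** (`q = m + 1 + (k + 1)`, `k ≥ 13`, `m + 1 ≥ k²`):
`C(2k+1, k−1)·S_k(q, m) ≤ S_1(q, m)`. -/
lemma step_fourth (k m : ℕ) (hk : 13 ≤ k) (hm : k * k ≤ m + 1) :
    ((k + 1 + k).choose (k - 1) : ℚ) * sliceS (m + 1 + (k + 1)) m k ≤ sliceS (m + 1 + (k + 1)) m 1 := by
  set d := (k - 1) / 2 with hd
  have hd6 : 6 ≤ d := by omega
  have hlow := sliceS_one_ge m (k + 1)
  have hup := sliceS_le_odd m k d (show m + 1 ≤ m + 1 + (k + 1) by omega) (by omega)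
  have hρ := diag_two_sq_le_sharper m
  have hρ0 : (0 : ℚ) ≤ 2 * sliceS (m + 1) m 2 := by
    have := sliceS_nonneg (m + 1) m 2; positivity
  have hkq : (13 : ℚ) ≤ k := by exact_mod_cast hk
  have hmq : (k : ℚ) * k ≤ (m : ℚ) + 1 := by exact_mod_cast hm
  have h1 : ((k : ℚ) + 1) * (2 * sliceS (m + 1) m 2) ≤ 26 / 27 := by
    have hsq : (((k : ℚ) + 1) * (2 * sliceS (m + 1) m 2)) ^ 2 ≤ (26 / 27) ^ 2 := by
      calc (((k : ℚ) + 1) * (2 * sliceS (m + 1) m 2)) ^ 2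
          = ((k : ℚ) + 1) ^ 2 * (2 * sliceS (m + 1) m 2) ^ 2 := by ring
        _ ≤ ((k : ℚ) + 1) ^ 2 * (4 / (5 * (m : ℚ) + 9)) := by gcongr
        _ ≤ (26 / 27) ^ 2 := by
            rw [show ((k : ℚ) + 1) ^ 2 * (4 / (5 * (m : ℚ) + 9)) = 4 * ((k : ℚ) + 1) ^ 2 / (5 * (m : ℚ) + 9) by
              field_simp, div_le_iff₀ (by positivity)]
            nlinarith
    nlinarith [hsq, hρ0]
  have hT := tK4 k hk
  rw [← hd] at hT
  have hCle : 54 * (k + 1 + k).choose (k - 1) ≤ 27 * (2 * (k + 1)).choose (k + 1) := by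
    have e1 : (k + 1 + k).choose (k - 1) ≤ (2 * k + 1).choose k := by
      have := Nat.choose_le_middle (k - 1) (2 * k + 1)
      rw [show (2 * k + 1) / 2 = k by omega] at this
      rw [show k + 1 + k = 2 * k + 1 by ring]
      exact this
    have e2 := choose_odd_mul_two k
    rw [show 2 * k + 2 = 2 * (k + 1) by ring] at e2
    omega
  have hmono : ((k * k + d).choose d : ℚ) ≤ ((m + d + 1).choose d : ℚ) := by
    exact_mod_cast Nat.choose_le_choose d (by omega)
  have hTq : (27 : ℚ) * ((k + 1 + k).choose (k - 1) : ℚ) ≤ ((m + d + 1).choose d : ℚ) := by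
    have : 27 * (k + 1 + k).choose (k - 1) ≤ (k * k + d).choose d := by omega
    have e : (27 : ℚ) * ((k + 1 + k).choose (k - 1) : ℚ) ≤ ((k * k + d).choose d : ℚ) := by exact_mod_cast this
    exact e.trans hmono
  have hB : (0 : ℚ) < ((m + d + 1).choose d : ℚ) := Nat.cast_pos.mpr (Nat.choose_pos (by omega))
  have h2 : ((k + 1 + k).choose (k - 1) : ℚ) / ((m + d + 1).choose d : ℚ) ≤ 1 / 27 := by
    rw [div_le_iff₀ hB]; linarith
  calc ((k + 1 + k).choose (k - 1) : ℚ) * sliceS (m + 1 + (k + 1)) m k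
      ≤ ((k + 1 + k).choose (k - 1) : ℚ)
          * (((m + 1 + (k + 1) : ℕ) : ℚ) / ((m : ℚ) + 1) * (1 / (2 * ((m + d + 1).choose d : ℚ)))) :=
        mul_le_mul_of_nonneg_left hup (by positivity)
    _ = ((k + 1 + k).choose (k - 1) : ℚ) / ((m + d + 1).choose d : ℚ)
          * (((m + 1 + (k + 1) : ℕ) : ℚ) / (2 * ((m : ℚ) + 1))) := by
        field_simp
    _ ≤ 1 / 27 * (((m + 1 + (k + 1) : ℕ) : ℚ) / (2 * ((m : ℚ) + 1))) :=
        mul_le_mul_of_nonneg_right h2 (by positivity)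
    _ ≤ ((m + 1 + (k + 1) : ℕ) : ℚ) / (2 * ((m : ℚ) + 1)) * (1 - ((k + 1 : ℕ) : ℚ) * (2 * sliceS (m + 1) m 2)) := by
        have hy0 : (0 : ℚ) ≤ ((m + 1 + (k + 1) : ℕ) : ℚ) / (2 * ((m : ℚ) + 1)) := by positivity
        have h1' : ((k + 1 : ℕ) : ℚ) * (2 * sliceS (m + 1) m 2) ≤ 26 / 27 := by push_cast; exact h1
        have := mul_le_mul_of_nonneg_left h1' hy0
        nlinarith [this, hy0]
    _ ≤ sliceS (m + 1 + (k + 1)) m 1 := hlow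

/-- **THE LARGE-q HALF OF `u = k + 2`** (`k ≥ 13`, `m + 1 ≥ k²`, `q = m + k + 2`): `Φ(q+k, q) ≤ R̂(q, k, m)`. -/
theorem fourth_untrunc_large (k m : ℕ) (hk : 13 ≤ k) (hm : k * k ≤ m + 1) :
    phiK (m + 1 + (k + 1) + k) (m + 1 + (k + 1)) ≤ rhat (m + 1 + (k + 1)) k m := by
  have h1 : phiK (m + 1 + (k + 1) + k) (m + 1 + (k + 1)) ≤ rhat (m + 1 + (k + 1)) k (m + 1) := by
    have := third_untrunc_slice_every k (m + 1 + (k + 1)) (by omega) (by omega)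
    rwa [show m + 1 + (k + 1) - (k + 1) = m + 1 by omega] at this
  have h2 := rhat_le_sliceL_of_untrunc (m + 1 + (k + 1)) k (m + 1) (by omega)
  have h1' : phiK (m + 1 + (k + 1) + k) (m + 1 + (k + 1))
      ≤ ∑ j ∈ Finset.Ioo 0 k, ((m + 1 + (k + 1) + k - (m + 1)).choose j : ℚ)
          * ∑ a ∈ range (m + 1 + 1), ((m + 1).choose a : ℚ) / ((m + 1 + (k + 1) + j + a).choose (a + j) : ℚ) :=
    h1.trans h2
  exact phiK_le_rhat_of_sliceStep (k + 1) k m (by omega) h1' (step_fourth k m hk hm)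

/-! ### §5 The theorem -/

/-- **THE FOURTH UNTRUNCATED SLICE `u = k + 2` IS PAID ON EVERY CELL OF EVERY FAMILY `k ≥ 13`**:
`Φ(q+k, q) ≤ R̂(q, k, q − (k+2))` for every `q ≥ k + 2`. -/
theorem fourth_untrunc_slice_every (k q : ℕ) (hk : 13 ≤ k) (hq : k + 2 ≤ q) :
    phiK (q + k) q ≤ rhat q k (q - (k + 2)) := by
  obtain ⟨m, rfl⟩ : ∃ m, q = m + (k + 2) := ⟨q - (k + 2), by omega⟩
  rw [show m + (k + 2) - (k + 2) = m by omega]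
  rcases Nat.lt_or_ge m 3 with hm3 | hm3
  · rcases Nat.lt_or_ge m 1 with hm0 | hm1
    · have : m = 0 := by omega
      subst this
      rw [rhat_zero_eq _ _ (by omega)]
    · rcases Nat.lt_or_ge m 2 with hm1' | hm2
      · have : m = 1 := by omega
        subst this
        exact rhatCell_one (1 + (k + 2)) k (by omega) (by omega)
      · have : m = 2 := by omega
        subst this
        exact fourth_untrunc_two k hk
  · rcases Nat.lt_or_ge (m + 1) (k * k) with hsmall | hlarge
    · exact fourth_untrunc_bottom k m hk hm3 (by omega)
    · have := fourth_untrunc_large k m hk (by omega)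
      rwa [show m + 1 + (k + 1) = m + (k + 2) by ring] at this

/-- **THE MATROID LEVEL**: at the tight layer every member at distance `k + 2` from the top is paid (`k ≥ 13`, `q ≥ k + 2`). -/
theorem ruleQRecv_ge_phiK_fourth_untrunc_every {β : Type} (M : Matroid β) [M.Finite] {q k : ℕ} (hk : 13 ≤ k)
    (hq : k + 2 ≤ q) (hE : M.E.ncard = (q + k) + q) {Z : Set β} (hZ : Z ∈ cellMembers M (q + k) q)
    (hP : (flatPart M Z).ncard = q - (k + 2)) :
    phiK (q + k) q ≤ ruleQRecv M (q + k) q Z := by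
  have h1 := fourth_untrunc_slice_every k q hk hq
  have h2 := rhat_le_ruleQRecv M hE hZ
  rw [hP] at h2
  exact h1.trans h2

end PercRepro
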